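import Summits.QuantumFields.BalabanUV.T4Continuum.Support.ShellMeasureRootCompositionLevelZero

/-!
# `T4Continuum.ShellMeasureWindowBall` — (LR)_j FROM PRINT'S BOND WINDOW: END-II with the window factorisation DERIVED
# from a `dist1`-ball support of the realized density about the chart centre (the shape of [Balaban1989LargeFieldI]
# (1.27) p. 182 ∕ (1.7) p. 178), at ANY level `j` (cell `pub-balaban`, sub-cell `t4`, spine estimate NE7c (node U5b);
# NE7c ROUND-2 crew `t4-ne7c-formalise-*`, seat leaf-10, row S20 of the owner's claim table
# `t4/b2b-balaban-t4-ne7c-p1/LEAVES-NE7c-P1.md` (RECUT journal l.6826), companion of row S15 `ShellMeasureWindowInsertion`;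
# ADDITIVE — imports the `_cube` END-II `ShellMeasureRootCompositionLevelZero` (p208890, leaf-09) only, modifies nothing)

HONEST FRAMING.  Finite four-torus programme, rung (B)+1 only — NOT infinite volume, NOT a mass gap, NOT the Clay
problem, NOT summit progress; (B), `BetaPertHyp`, (B^μ) are not consumed.  (M1) for Bałaban's inductively defined
effective measures is NOT PRINTED (GAPS G-ne7cp1-1), asserted by nobody, NOT moved here.  NE7c ⇐ the named binders
(trigger c3); NE7c NOT PRINTED, NOT proved; spine PROVED 0/9 before and after.  STRUCTURAL BOOKKEEPING — no estimate,
0 sorry, 0 citations (the locators below say where a SHAPE is displayed; nothing printed is transcribed as a fact), no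
`def … : Prop` (c2).  HONEST DEPENDENCY (cell): continuum YM on T⁴ ⇐ BetaPertH ∧ nine spine estimates (0/9 proved);
BetaPertH ⇐ (D1) ∧ (D4) ∧ CAP+tail; G-an2-4 gates asym, D1 and NE2/3/4.

THE POINT.  END-II (`ShellMeasureRootCompositionSU2.slotAC_realized_su2_of_levelData`, cube form
`ShellMeasureRootCompositionLevelZero.slotAC_realized_su2_of_levelData_cube`) carries the WINDOW FACTORISATION binder
`hFw : F (fixTo T U₀ (V[Λ := y])) = χ_{Λ,cV,S}((cV)[Λ := y]) · R V y` («(LR)_j assumed as the window», swarm referee DV-5).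
Print's level-`j` density DOES carry a bond window: the characteristic function (1.27) p. 182 (and (1.7) p. 178)
`χ({|V_j(b)(V^{(j)}_Z(b))⁻¹ − 1| < 2δ′_j, b ∈ region})` restricts every bond variable of the integration field `V_j` to a
`dist1`-ball about the background `V^{(j)}_Z` — a SHAPE (locator, not a citation).  This file shows that such a ball
SUPPORT is all END-II needs:
* §1 `window_of_ballSupport` — for ANY tree `T`, values `U₀`, chart bonds `Λ`, centre field `c`, `0 ≤ S`: if the
  `T`-gauged sections of `F` vanish unless every chart bond is in the chord ball `dist1 ((c V b)⁻¹ y_b) ≤ 2 sin(S/2)`, then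
  `hFw` HOLDS with `R V y := F (fixTo T U₀ (V[Λ := y]))` (`T4ExpWindowSmallField.expWindowDensity_eq_one_of_dist1_bdev_le`).
  `ballSupport_of_indicator_mul`: the concrete density `1[∀ b ∈ Λ, dist1 ((c U b)⁻¹·U b) ≤ τ]·G` has this support
  whenever the centre is Λ-blind and gauge-compatible on the block (located reading (1.26)).
* §2 `dist1_chart_smul_le`, `ballInd_le_smul` — read in the chart about `c V`, the bond deviation is
  `dist1 (exp(ι x_b)) = 2|sin(‖x_b‖/2)|`, NON-DECREASING in `‖x_b‖` on the injectivity ball; hence a ball co-test (times the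
  cube indicator) is CENTRE-MONOTONE along `x ↦ e^{−a}x` — END-II's `hJ` shape — with NO smallness hypothesis.
* §3 `slotAC_realized_su2_of_levelData_ballWindow` — the cube END-II RE-EXPORTED with `hFw`∕`R`∕`hR` replaced by the
  support hypothesis `hFsupp`; the dictionary reads the density's own section `F (fixTo T U₀ (V[Λ := κ_{cV}(x)]))` on the
  cube; conclusion LITERALLY END-II's.
* §4 `dist1_print_window` — print's `|W·g⁻¹ − 1|` IS our `dist1 (g⁻¹·W)` (`T4TiltOscillation.dist1_mul_inv_eq`-type).
CONSEQUENCE FOR THE LEDGER.  (LR)_j at a live level = the located READING «the slot's realized density (own indicator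
removed) keeps the bond window (1.27) of radius `2δ′_j ≤ 2 sin(S_j/2)` about a Λ-BLIND, `T`-gauge-compatible centre
`c V = V^{(j)}_Z` on the block's chart bonds» — displayed SHAPE (1.27)/(1.7), located centre; row S15 gives the sibling
reduction to plaquette co-tests.  Neither is an estimate.
WHAT THIS DOES NOT DO.  No instance of SM-L1/L3/L4/L6 at any `j ≥ 1`; the Λ-blindness of Bałaban's background
`V^{(j)}_Z` on the block is NOT proved here (located: (1.26) p. 182); NE7c NOT proved; 0/9 spine.
-/

noncomputable section

open NormedSpace Set Function MeasureTheory Metric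

namespace Summit.QuantumFields.BalabanUV.T4Continuum.ShellMeasureWindowBall

open scoped ENNReal Matrix.Norms.L2Operator
open Literature.MathematicalPhysics.QuantumFieldTheory.Balaban1983to89
open GaugeField (GaugeInvariant)
open T4ShellMeasure (SlotAntiConcentration)
open T4CubePoincare (cube)
open T4CubeChartGnomonic (SU2)
open T4CubeChartExp (toE expPt expChart expFibreChart expWindowDensity block_mem_cube toE_mem_ball_of_mem_cube)
open T4ShellMeasureDet (blockLaw)
open T4TreeGaugeFixing (NoClosedLoop fixTo measurable_fixTo)
open ShellMeasureHeadlines (fixTo_updateFinset_of_disjoint)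
open T4TiltOscillation (bdev dist1_mul_inv_eq updateFinset_apply_of_mem)
open T4ExpWindowSmallField (dist1_inv_mul_expChart dist1_expPt_eq expWindowDensity_eq_one_of_dist1_bdev_le)
open ShellMeasureScalingSU2 (smul_mem_cube)
open ShellMeasureWilsonTrace (TraceData)
open ShellMeasureWilsonMoving (MLetter mwordEval mdFro sSum lSum)
open ShellMeasureLevelAssembly (classifier weight)
open ShellMeasureRootCompositionLevelZero (slotAC_realized_su2_of_levelData_cube)

variable {P : Params} {j : ℕ} [DecidableEq (PBond P j)]

/-! ## §1 The window factorisation from a `dist1`-ball support about the centre -/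

section Window

/-- **END-II's `hFw` FROM A BALL SUPPORT, ANY LEVEL, ANY DENSITY, ANY CENTRE.**  Tree `T`, values `U₀`, chart bonds `Λ`,
centre field `c`, `0 ≤ S`: if the `T`-gauged sections of `F` vanish unless every chart bond sits in the chord ball
`dist1 ((c V b)⁻¹ · y_b) ≤ 2 sin(S/2)` (the SHAPE of print's (1.27)), then
`F (fixTo T U₀ (V[Λ := y])) = χ_{Λ,cV,S}((cV)[Λ := y]) · F (fixTo T U₀ (V[Λ := y]))`. [folklore] -/
theorem window_of_ballSupport (T : Finset (PBond P j)) (U₀ : GaugeField P j SU2) (Λ : Finset (PBond P j))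
    (c : GaugeField P j SU2 → GaugeField P j SU2) {S : ℝ} (hS : 0 ≤ S) {F : GaugeField P j SU2 → ℝ≥0∞}
    (hFsupp : ∀ V y, F (fixTo T U₀ (updateFinset V Λ y)) ≠ 0 →
      ∀ b (hb : b ∈ Λ), dist1 ((c V b)⁻¹ * y ⟨b, hb⟩) ≤ 2 * Real.sin (S / 2))
    (V : GaugeField P j SU2) (y : ↥Λ → SU2) :
    F (fixTo T U₀ (updateFinset V Λ y)) =
      ENNReal.ofReal (expWindowDensity Λ (c V) S (updateFinset (c V) Λ y)) * F (fixTo T U₀ (updateFinset V Λ y)) := by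
  by_cases h0 : F (fixTo T U₀ (updateFinset V Λ y)) = 0
  · rw [h0, mul_zero]
  · have hwin : expWindowDensity Λ (c V) S (updateFinset (c V) Λ y) = 1 :=
      expWindowDensity_eq_one_of_dist1_bdev_le hS fun b hb => by
        rw [bdev, updateFinset_apply_of_mem _ _ hb]
        exact hFsupp V y h0 b hb
    rw [hwin, ENNReal.ofReal_one, one_mul]

/-- **THE CONCRETE CO-TESTED DENSITY HAS THE BALL SUPPORT.**  For `F = 1[∀ b ∈ Λ, dist1 ((c U b)⁻¹·U b) ≤ τ] · G` (print's
(1.27) window as an indicator factor, `G` arbitrary): if `Λ` avoids the tree `T` and the centre read on a `T`-gauged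
section is the designated one (`c (fixTo T U₀ (V[Λ := y])) b = c V b` on `Λ` — the centre is Λ-BLIND and gauge-compatible,
located reading (1.26)), then the `T`-gauged sections of `F` vanish unless every chart bond is in the `τ`-ball about
`c V` — the hypothesis `hFsupp` of §3 (take `τ ≤ 2 sin(S/2)`). [folklore] -/
theorem ballSupport_of_indicator_mul (T : Finset (PBond P j)) (U₀ : GaugeField P j SU2) (Λ : Finset (PBond P j))
    (hΛT : Disjoint Λ T) (c : GaugeField P j SU2 → GaugeField P j SU2)
    (hc : ∀ V y, ∀ b ∈ Λ, c (fixTo T U₀ (updateFinset V Λ y)) b = c V b) (τ : ℝ) (G : GaugeField P j SU2 → ℝ≥0∞)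
    (V : GaugeField P j SU2) (y : ↥Λ → SU2)
    (hne : {U : GaugeField P j SU2 | ∀ b (hb : b ∈ Λ), dist1 ((c U b)⁻¹ * U b) ≤ τ}.indicator
        (1 : GaugeField P j SU2 → ℝ≥0∞) (fixTo T U₀ (updateFinset V Λ y)) * G (fixTo T U₀ (updateFinset V Λ y)) ≠ 0) :
    ∀ b (hb : b ∈ Λ), dist1 ((c V b)⁻¹ * y ⟨b, hb⟩) ≤ τ := by
  intro b hb
  have hmem : fixTo T U₀ (updateFinset V Λ y) ∈
      {U : GaugeField P j SU2 | ∀ b (hb : b ∈ Λ), dist1 ((c U b)⁻¹ * U b) ≤ τ} := by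
    by_contra h
    exact hne (by rw [indicator_of_notMem h, zero_mul])
  have h := hmem b hb
  rwa [hc V y b hb, fixTo_updateFinset_of_disjoint hΛT, updateFinset_apply_of_mem _ _ hb] at h

end Window

/-! ## §2 The ball co-test read in the chart is centre-monotone (no smallness needed) -/

section Ball

variable (Λ : Finset (PBond P j)) {n : ℕ} (e : ↥Λ × Fin 3 ≃ Fin n)

omit [DecidableEq (PBond P j)] in
/-- in the chart about `g = c V`: the deviation of the chart bond `b` at the point `x` is `dist1 (exp(ι x_b))`.
[folklore] -/
theorem dist1_inv_mul_chart (g : GaugeField P j SU2) (x : Fin n → ℝ) (b : ↥Λ) :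
    dist1 ((g b)⁻¹ * expFibreChart Λ g e x b) = dist1 (expPt fun i => x (e (b, i))) :=
  dist1_inv_mul_expChart _ _

omit [DecidableEq (PBond P j)] in
/-- **THE BOND DEVIATION DOES NOT INCREASE TOWARDS THE CENTRE**: on the cube `[-S,S]ⁿ` (`3S² < π²`), for `0 ≤ c' ≤ 1`,
`dist1 ((g b)⁻¹ κ_g(c'•x)_b) ≤ dist1 ((g b)⁻¹ κ_g(x)_b)` (`dist1 (exp(ι v)) = 2|sin(‖v‖/2)|`, `sin` monotone on `[0, π/2]`).
[folklore] -/
theorem dist1_chart_smul_le (g : GaugeField P j SU2) {S : ℝ} (hSπ : 3 * S ^ 2 < Real.pi ^ 2) {x : Fin n → ℝ}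
    (hx : x ∈ cube n S) {c' : ℝ} (hc0 : 0 ≤ c') (hc1 : c' ≤ 1) (b : ↥Λ) :
    dist1 ((g b)⁻¹ * expFibreChart Λ g e (c' • x) b) ≤ dist1 ((g b)⁻¹ * expFibreChart Λ g e x b) := by
  rw [dist1_inv_mul_chart, dist1_inv_mul_chart, dist1_expPt_eq, dist1_expPt_eq]
  have hblock : (fun i => (c' • x) (e (b, i))) = c' • fun i => x (e (b, i)) := by
    funext i; simp [Pi.smul_apply, smul_eq_mul]
  have he : toE (fun i => (c' • x) (e (b, i))) = c' • toE (fun i => x (e (b, i))) := by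
    rw [hblock]; exact WithLp.toLp_smul _ _ _
  set r := ‖toE (fun i => x (e (b, i)))‖ with hr
  have hrπ : r < Real.pi := by
    have h := toE_mem_ball_of_mem_cube hSπ (block_mem_cube e hx b)
    rwa [mem_ball_zero_iff] at h
  have hr0 : 0 ≤ r := norm_nonneg _
  rw [he, norm_smul, Real.norm_of_nonneg hc0]
  have h1 : 0 ≤ Real.sin (c' * r / 2) :=
    Real.sin_nonneg_of_nonneg_of_le_pi (by positivity) (by nlinarith [Real.pi_pos])
  have h2 : 0 ≤ Real.sin (r / 2) := Real.sin_nonneg_of_nonneg_of_le_pi (by positivity) (by linarith)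
  rw [abs_of_nonneg h1, abs_of_nonneg h2]
  refine mul_le_mul_of_nonneg_left (Real.sin_le_sin_of_le_of_le_pi_div_two ?_ ?_ ?_) (by norm_num)
  · linarith [Real.pi_pos, mul_nonneg hc0 hr0]
  · linarith
  · nlinarith

omit [DecidableEq (PBond P j)] in
/-- **THE BALL CO-TEST (times the cube indicator) IS CENTRE-MONOTONE** along `x ↦ e^{−a}x`, `a ≥ 0`, at EVERY chart point:
`1[x ∈ cube ∧ ∀ b, dist1 ((g b)⁻¹ κ_g(x)_b) < τ] ≤` the same at `e^{−a}•x` — END-II's kept-co-test binder `hJ` for the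
window (1.27) read in the chart, with NO smallness hypothesis. [folklore] -/
theorem ballInd_le_smul (g : GaugeField P j SU2) {S : ℝ} (hSπ : 3 * S ^ 2 < Real.pi ^ 2) (τ : ℝ) (x : Fin n → ℝ)
    {a : ℝ} (ha : 0 ≤ a) :
    {x : Fin n → ℝ | x ∈ cube n S ∧ ∀ b : ↥Λ, dist1 ((g b)⁻¹ * expFibreChart Λ g e x b) < τ}.indicator
        (1 : (Fin n → ℝ) → ℝ≥0∞) x ≤
      {x : Fin n → ℝ | x ∈ cube n S ∧ ∀ b : ↥Λ, dist1 ((g b)⁻¹ * expFibreChart Λ g e x b) < τ}.indicator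
        (1 : (Fin n → ℝ) → ℝ≥0∞) (Real.exp (-a) • x) := by
  by_cases hx : x ∈ {x : Fin n → ℝ | x ∈ cube n S ∧ ∀ b : ↥Λ, dist1 ((g b)⁻¹ * expFibreChart Λ g e x b) < τ}
  · have hc0 : 0 ≤ Real.exp (-a) := (Real.exp_pos _).le
    have hc1 : Real.exp (-a) ≤ 1 := by rw [Real.exp_le_one_iff]; linarith
    have hx' : Real.exp (-a) • x ∈
        {x : Fin n → ℝ | x ∈ cube n S ∧ ∀ b : ↥Λ, dist1 ((g b)⁻¹ * expFibreChart Λ g e x b) < τ} :=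
      ⟨smul_mem_cube hx.1 hc0 hc1, fun b => (dist1_chart_smul_le Λ e g hSπ hx.1 hc0 hc1 b).trans_lt (hx.2 b)⟩
    rw [indicator_of_mem hx, indicator_of_mem hx']
    simp only [Pi.one_apply, le_refl]
  · rw [indicator_of_notMem hx]
    exact bot_le

end Ball

/-! ## §3 END-II with the window DERIVED from the ball support -/

section EndTwo

variable {A : Type*} [NormedRing A] [NormedAlgebra ℂ A] [CompleteSpace A] [NormOneClass A]

/-- **END-II, BALL-WINDOW FORM — REALIZED (M1) ⇐ SM-L1…L4 + (SM) + DICTIONARY, PER SLOT, ANY LEVEL; THE WINDOW IS A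
SUPPORT PROPERTY OF THE DENSITY (print's (1.27) SHAPE), NOT A FACTORISATION BINDER (`G = SU(2)`).**  Exactly the cube
END-II `ShellMeasureRootCompositionLevelZero.slotAC_realized_su2_of_levelData_cube` (tree `T` loop-free, values `U₀`,
chart bonds `Λ`, enumeration `e`, `0 < S`, `3S² < π²`, centre field `c`; gauge-invariant measurable `F` and `u`;
per-section finiteness; level data `hol Gw 𝓔 W Jco` with SM-L1 `hAN`, SM-L3 `hGW` + sizes, SM-L4 `hE`, SM-L5/L6
`hJW`∕`hJ`, numbers, SM-L2 `hSM`) with the binders `R`, `hR`, `hFw` REPLACED by the support hypothesis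
`hFsupp : F (fixTo T U₀ (V[Λ := y])) ≠ 0 → ∀ b ∈ Λ, dist1 ((c V b)⁻¹ y_b) ≤ 2 sin(S/2)` and the dictionary read on the
density's own sections: `hFdict : ∀ V, ∀ x ∈ cube, F (fixTo T U₀ (V[Λ := κ_{cV}(x)])) = Jco V x · weight Ttr β P_w (Gw V) (𝓔 V) x`
(the window indicator of `F` is one of the kept co-tests inside `Jco`; §2 `ballInd_le_smul` is its `hJ`).  CONCLUSION
(LITERALLY END-II's): `SlotAntiConcentration ((fieldMeasure P j SU2).withDensity F) u θ ρ (2(n + βΣ_p L̄_p(d̄_p + 4s̄_p) + B_𝓔)/(1−δ))`.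
CONDITIONAL on every displayed binder; nothing PRINTED is asserted. [folklore] -/
theorem slotAC_realized_su2_of_levelData_ballWindow {T : Finset (PBond P j)} (hT : NoClosedLoop T)
    (U₀ : GaugeField P j SU2) (Λ : Finset (PBond P j)) {n : ℕ} (e : ↥Λ × Fin 3 ≃ Fin n)
    {S : ℝ} (hS : 0 < S) (hSπ : 3 * S ^ 2 < Real.pi ^ 2) (c : GaugeField P j SU2 → GaugeField P j SU2)
    {F : GaugeField P j SU2 → ℝ≥0∞} (hF : Measurable F) (hFi : GaugeInvariant F)
    (hFsupp : ∀ V y, F (fixTo T U₀ (updateFinset V Λ y)) ≠ 0 →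
      ∀ b (hb : b ∈ Λ), dist1 ((c V b)⁻¹ * y ⟨b, hb⟩) ≤ 2 * Real.sin (S / 2))
    (hfin : ∀ V, ((blockLaw Λ).withDensity fun y => F (fixTo T U₀ (updateFinset V Λ y))) univ ≠ ∞)
    {u : GaugeField P j SU2 → ℝ} (hu : Measurable u) (hui : GaugeInvariant u)
    -- level data per exterior section (END-II's, verbatim)
    (Ttr : TraceData A) (hN : 0 < Ttr.N) {ι κ : Type*} {Pu : Finset ι} (hPu : Pu.Nonempty)
    (hol : GaugeField P j SU2 → ι → (Fin n → ℝ) → A) (hcont : ∀ V, ∀ p ∈ Pu, Continuous (hol V p))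
    (Pw : Finset κ) (Gw : GaugeField P j SU2 → κ → (Fin n → ℝ) → A) (𝓔 : GaugeField P j SU2 → (Fin n → ℝ) → ℝ)
    (W : GaugeField P j SU2 → Set (Fin n → ℝ)) (Jco : GaugeField P j SU2 → (Fin n → ℝ) → ℝ≥0∞)
    {θ δ ρ β Rad H B𝓔 : ℝ} {sw lw dw : κ → ℝ}
    -- DICTIONARY (the density's own sections, on the chart cube only) and classifier dictionary
    (hFdict : ∀ V, ∀ x ∈ cube n S,
      F (fixTo T U₀ (updateFinset V Λ (expFibreChart Λ (c V) e x))) = Jco V x * weight Ttr β Pw (Gw V) (𝓔 V) x)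
    (hudict : ∀ V, ∀ x ∈ cube n S,
      u (fixTo T U₀ (updateFinset V Λ (expFibreChart Λ (c V) e x))) = classifier hPu (hol V) x)
    -- SM-L5/L6: kept co-tests supported in the window, centre-monotone
    (hJW : ∀ V x, Jco V x ≠ 0 → x ∈ W V)
    (hJ : ∀ V x, ∀ a : ℝ, 0 ≤ a → Jco V x ≤ Jco V (Real.exp (-a) • x))
    -- SM-L1 (AN-bound)
    (hRad : 1 < Rad)
    (hAN : ∀ V, ∀ x ∈ W V, ∀ p ∈ Pu, ∃ f : ℂ → A, DifferentiableOn ℂ f (ball 0 Rad) ∧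
      (∀ w ∈ ball (0 : ℂ) Rad, ‖f w‖ ≤ H) ∧ f 0 = 0 ∧ ∀ c' : ℝ, 0 ≤ c' → c' ≤ 1 → f (c' : ℂ) = hol V p (c' • x) - 1)
    -- SM-L3 graded sectioned words
    (hGW : ∀ V, ∀ x ∈ W V, ∀ p ∈ Pw, ∃ gw : List (MLetter A × ℝ × ℝ), (∀ y ∈ gw, y.1.Good Ttr.τ y.2.1 y.2.2) ∧
      sSum gw ≤ sw p ∧ lSum gw ≤ lw p ∧ mdFro (gw.map Prod.fst) ≤ dw p ∧
      ∀ c' : ℝ, 0 ≤ c' → c' ≤ 1 → mwordEval c' (gw.map Prod.fst) = Gw V p (c' • x))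
    (hsw1 : ∀ p ∈ Pw, sw p ≤ 1) (hsw0 : ∀ p ∈ Pw, 0 ≤ sw p) (hlw0 : ∀ p ∈ Pw, 0 ≤ lw p)
    (hdw0 : ∀ p ∈ Pw, 0 ≤ dw p)
    -- SM-L4 non-Wilson ray bound
    (hE : ∀ V, ∀ x ∈ W V, ∀ c' : ℝ, 1 / 2 ≤ c' → c' ≤ 1 → 𝓔 V (c' • x) ≤ 𝓔 V x + (1 - c') * B𝓔) (hB𝓔 : 0 ≤ B𝓔)
    -- numbers + SM-L2 (SM)
    (hθ : 0 < θ) (hδ0 : 0 ≤ δ) (hδ1 : δ < 1) (hρ0 : 0 ≤ ρ) (hρ : ρ ≤ (1 - δ) / 2) (hβ : 0 ≤ β)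
    (hSM : 36 * H * 1 ^ 2 / (Rad - 1) ^ 2 ≤ δ * θ) :
    SlotAntiConcentration ((fieldMeasure P j SU2).withDensity F) u θ ρ
      (2 * ((n : ℝ) + (β * ∑ p ∈ Pw, lw p * (dw p + 4 * sw p) + B𝓔)) / (1 - δ)) :=
  slotAC_realized_su2_of_levelData_cube hT U₀ Λ e hS hSπ c
    (R := fun V y => F (fixTo T U₀ (updateFinset V Λ y)))
    (fun _ => hF.comp ((measurable_fixTo T U₀).comp measurable_updateFinset)) hF hFi
    (window_of_ballSupport T U₀ Λ c hS.le hFsupp) hfin hu hui Ttr hN hPu hol hcont Pw Gw 𝓔 W Jco hFdict hudict hJW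
    hJ hRad hAN hGW hsw1 hsw0 hlw0 hdw0 hE hB𝓔 hθ hδ0 hδ1 hρ0 hρ hβ hSM

end EndTwo

/-! ## §4 Dictionary with print's window and sanity -/

section Print

/-- **PRINT'S WINDOW IS OUR BALL**: `|W·g⁻¹ − 1|` ((1.27)/(1.7): `|V_j(b)(V^{(j)}(b))⁻¹ − 1|`) equals `dist1 (g⁻¹·W)`, the
deviation read by `hFsupp`. [folklore] -/
theorem dist1_print_window (W g : SU2) : dist1 (W * g⁻¹) = dist1 (g⁻¹ * W) := by
  rw [dist1_mul_inv_eq, ← GaugeGroup.dist1_inv (W⁻¹ * g), mul_inv_rev, inv_inv]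

/-- SANITY (radii): a print radius `2δ′ ≤ S∕2` fits the chord ball of the cube window, `2δ′ ≤ 2 sin(S/2)`, whenever
`0 ≤ S ≤ 1` (`sin t ≥ t − t³/6 ≥ t/2` there) — so at a live level one may take `S_j := 4δ′_j` (`δ′_j ≤ 1/4`). [folklore] -/
theorem radius_fits {S δ' : ℝ} (hS0 : 0 ≤ S) (hS1 : S ≤ 1) (hδ : 2 * δ' ≤ S / 2) : 2 * δ' ≤ 2 * Real.sin (S / 2) := by
  have h := Real.sin_ge_sub_cube (show 0 ≤ S / 2 by linarith)
  have hS3 : (S / 2) ^ 3 ≤ S / 2 := by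
    have h2 : (S / 2) ^ 2 ≤ 1 := by nlinarith
    nlinarith [h2]
  linarith

end Print

end Summit.QuantumFields.BalabanUV.T4Continuum.ShellMeasureWindowBall

end
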